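import Summits.BirchSwinnertonDyer.BirchSwinnertonDyer.Theorems.TwoAdicConverseMultiplicativeInputs
import Literature.NumberTheory.EllipticCurves.BSDSelmerParityDokchitserBaseChangeProofs
import HarnessLib

/-!
# Route `TwoAdicConverse`, multiplicative node: the RN-2 split is CIRCULAR at rank `0` —
# the crux child `MultTwoConverseOverKAtTwo` (stmt-BirchSwinnertonDyer-19187) is EQUIVALENT to its
# parent `MultiplicativeRankZeroTwoConverse` (stmt-BirchSwinnertonDyer-19219) modulo the PUB bundle

WHAT IS PROVED (seat bsd-2adic-conv-2, D-0074 (A) «find: 19219 likewise»; nothing asserted, no new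
object). Let `K` be ANY quadratic field with `L(E^(d_K),1) ≠ 0` (the «2 split» condition is not used).
Kato's finiteness at `p = 2` (Cor. 14.3, PRINT, `kato_finite_of_L_one_ne_zero · 2`) makes
`Sel_{2^∞}(E^(d_K)/ℚ)` finite, so by Dokchitser–Dokchitser Lemma 4.14 (PROVED in the tree,
`selmerCorank_baseChange_quadratic_holds`) `corank Sel_{2^∞}(E/K) = corank Sel_{2^∞}(E/ℚ) + 0`, and by
modularity (`hasEntireLFunction_rat`, PRINT) `ord_{s=1} L(E/K,s) = r_an(E) + 0`
(`analyticRankEK_eq_add_of`). Hence the over-`K` converse `X5.AddTwoL2.TwoConverseOverAt W K 0` at such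
a `K` is LITERALLY the rank-`0` 2-converse for `E` over `ℚ`:
* `twoConverseOverAt_zero_of_twoConverse` — parent-at-`W` ⇒ child-at-`(W, K)` for every such `K`;
* `multTwoConverseOverKAtTwo_of_multiplicativeRankZeroTwoConverse` — `MultConversePublishedInputsAtTwo →
  MultiplicativeRankZeroTwoConverse → MultTwoConverseOverKAtTwo` (parent ⇒ crux child);
* `multTwoConverseOverKAtTwo_iff_multiplicativeRankZeroTwoConverse` — given the two SUPPORT children
  (`MultConversePublishedInputsAtTwo`, `MultTwistSupplyAtTwo`) the crux child and the parent are
  EQUIVALENT (⇐ is the glue p409715 / item 19188);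
* `multTwoConverseOverKAtTwo_iff_of_hoffsteinLuo` — the same with the twist supply discharged by the
  named PRINT fact Hoffstein–Luo 1997 (p410645).
CONSEQUENCE for the planner / tribunal: at `r = 0` the RN-2 road (auxiliary quadratic field) does not
cut the crux — its «research child» 19187 carries exactly the content of 19219 (the Burungale–Skinner–
Tian–Wan over-`K` mechanism has content only where the over-`K` side has an input the `ℚ`-side lacks,
i.e. at `r = 1` via Heegner points, or through a TWO-variable main conjecture over `Λ_K`). The road that
DOES cut 19219 is the cyclotomic one: the rank-free K4ᵐ lower half `X5.O1.MultLowerDivisibilityAtTwoRat`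
(bridge p411646 `multiplicativeRankZeroTwoConverse_of_multLowerRat`). PARTITION: none — RANK axis
(S3 mult); companion formula cell X5@2 mult (K4ᵐ, B1·O1; 1 976 classes), owner bsd-2adic.
[cite: Kato2004Asterisque, Cor 14.3] [cite: DokchitserDokchitser2010, Lemma 4.14]
[cite: BurungaleSkinnerTianWan2024, Thm 4.3 and Prop 4.1 (arXiv:2409.01350 p. 82)]
-/

set_option autoImplicit false
set_option linter.dupNamespace false

noncomputable section

open scoped Classical

open WeierstrassCurve Literature.NumberTheory.EllipticCurves
  Literature.NumberTheory.EllipticCurves.Rank1Residual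
  Summit.BirchSwinnertonDyer.Rank1Residual.X5
  Summit.BirchSwinnertonDyer.BirchSwinnertonDyer.Theses.TwoAdicConverse

namespace Summit.BirchSwinnertonDyer.BirchSwinnertonDyer.Theorems

/-- **Parent-at-`W` ⇒ child-at-`(W,K)` (any quadratic `K` with non-vanishing twist).** For an elliptic
curve `E/ℚ` satisfying its own rank-`0` 2-converse `corank Sel_{2^∞}(E/ℚ) = 0 ⇒ r_an(E) = 0`, Kato's
finiteness at `2` (PRINT) and modularity (PRINT): for every quadratic `K` with `L(E^(d_K),1) ≠ 0`,
`X5.AddTwoL2.TwoConverseOverAt W K 0` holds — by Dokchitser–Dokchitser Lemma 4.14 (proved in the tree)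
`corank(E/K) = corank(E/ℚ) + corank(E^(d_K)/ℚ) = corank(E/ℚ) + 0`, and
`ord L(E/K) = r_an(E) + r_an(E^(d_K)) = r_an(E) + 0`. No hypothesis on the behaviour of `2` in `K`.
[cite: Kato2004Asterisque, Cor 14.3] [cite: DokchitserDokchitser2010, Lemma 4.14] -/
theorem twoConverseOverAt_zero_of_twoConverse
    (hKato : ∀ (V : WeierstrassCurve ℚ) [V.IsElliptic], kato_finite_of_L_one_ne_zero V 2)
    (hE : hasEntireLFunction_rat)
    (W : WeierstrassCurve ℚ) [W.IsElliptic] (hconv : W.selmerCorank 2 = 0 → W.analyticRank = 0)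
    (K : Type) [Field K] [NumberField K] (h2 : Module.finrank ℚ K = 2)
    (hL1 : (W.quadraticTwist (NumberField.discr K : ℚ)).entireLFunction 1 ≠ 0) :
    AddTwoL2.TwoConverseOverAt W K 0 := by
  intro hK0
  haveI : Fact (Nat.Prime 2) := ⟨Nat.prime_two⟩
  have hd : (NumberField.discr K : ℚ) ≠ 0 := by exact_mod_cast NumberField.discr_ne_zero K
  haveI := W.isElliptic_quadraticTwist hd
  -- Kato at `2`: the twist's `2^∞`-Selmer group is finite, hence of corank `0`
  obtain ⟨-, -, hfin⟩ := hKato (W.quadraticTwist (NumberField.discr K : ℚ)) hL1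
  haveI := hfin
  have h0 : (W.quadraticTwist (NumberField.discr K : ℚ)).selmerCorank 2 = 0 :=
    (W.quadraticTwist (NumberField.discr K : ℚ)).selmerCorank_eq_zero_of_finite 2
  -- Dokchitser–Dokchitser Lemma 4.14 (proved): coranks add under quadratic base change
  have hbc := selmerCorank_baseChange_quadratic_holds W K h2 2
  rw [hK0, h0, add_zero] at hbc
  -- the rank-`0` 2-converse over `ℚ` at `W`
  have hW : W.analyticRank = 0 := hconv hbc.symm
  -- modularity: `ord L(E/K) = r_an(E) + r_an(E^(d_K))`
  rw [analyticRankEK_eq_add_of hE W K, hW,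
    analyticRank_eq_zero_of_entireLFunction_one_ne_zero _ hL1]

/-- **Parent ⇒ crux child (items 19219 ⇒ 19187) modulo the PUB support 19185.**
`MultConversePublishedInputsAtTwo → MultiplicativeRankZeroTwoConverse → MultTwoConverseOverKAtTwo`:
the over-`K` corank-`0` 2-converse asked by the crux child holds at every admissible `K` as soon as the
parent holds at `W` (the admissibility clause «`2` split in `K`» is not even used). Composition of
`twoConverseOverAt_zero_of_twoConverse`; nothing asserted.
[cite: Kato2004Asterisque, Cor 14.3] [cite: DokchitserDokchitser2010, Lemma 4.14] -/
theorem multTwoConverseOverKAtTwo_of_multiplicativeRankZeroTwoConverse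
    (hP : MultConversePublishedInputsAtTwo) (h : MultiplicativeRankZeroTwoConverse) :
    MultTwoConverseOverKAtTwo := by
  unfold Summit.BirchSwinnertonDyer.BirchSwinnertonDyer.Theses.TwoAdicConverse.MultTwoConverseOverKAtTwo
  intro W _ _ hcm hmult K _ _ h2 _ hL1
  exact twoConverseOverAt_zero_of_twoConverse hP.1 hP.2 W (h W hcm hmult) K h2 hL1

/-- **The RN-2 split is circular at `r = 0` (items 19187 ⟺ 19219 modulo the two supports).** Given
the support children `MultConversePublishedInputsAtTwo` (Kato Cor. 14.3 at `2` ∧ modularity) and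
`MultTwistSupplyAtTwo` (a quadratic `K` with `2` split and `L(E^(d_K),1) ≠ 0`), the crux child
`MultTwoConverseOverKAtTwo` and the parent `MultiplicativeRankZeroTwoConverse` are EQUIVALENT:
`→` is the glue (p409715 `multiplicativeRankZeroTwoConverse_of_overK` with the proved
Dokchitser–Dokchitser Lemma 4.14 inserted), `←` is
`multTwoConverseOverKAtTwo_of_multiplicativeRankZeroTwoConverse`. Nothing asserted.
[cite: Kato2004Asterisque, Cor 14.3] [cite: DokchitserDokchitser2010, Lemma 4.14]
[cite: BurungaleSkinnerTianWan2024, Thm 4.3 and Prop 4.1 (arXiv:2409.01350 p. 82)] -/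
theorem multTwoConverseOverKAtTwo_iff_multiplicativeRankZeroTwoConverse
    (hP : MultConversePublishedInputsAtTwo) (hT : MultTwistSupplyAtTwo) :
    MultTwoConverseOverKAtTwo ↔ MultiplicativeRankZeroTwoConverse :=
  ⟨fun hK => multiplicativeRankZeroTwoConverse_of_overK
      ⟨hP.1, selmerCorank_baseChange_quadratic_holds, hP.2⟩ hT hK,
    multTwoConverseOverKAtTwo_of_multiplicativeRankZeroTwoConverse hP⟩

/-- **The same equivalence with the twist supply discharged by Hoffstein–Luo 1997 (PRINT).** Modulo
the PUB support `MultConversePublishedInputsAtTwo` and the named fact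
`HoffsteinLuo1997_exists_twist_L_one_ne_zero` (via p410645
`existsNonvanishingTwistWith_twoSplit_of_hoffsteinLuo`): `MultTwoConverseOverKAtTwo ↔
MultiplicativeRankZeroTwoConverse`. Nothing asserted. [cite: HoffsteinLuo1997, Theorem (§1, pp. 435–436)]
[cite: Kato2004Asterisque, Cor 14.3] [cite: DokchitserDokchitser2010, Lemma 4.14] -/
theorem multTwoConverseOverKAtTwo_iff_of_hoffsteinLuo
    (hP : MultConversePublishedInputsAtTwo) (hHL : HoffsteinLuo1997_exists_twist_L_one_ne_zero) :
    MultTwoConverseOverKAtTwo ↔ MultiplicativeRankZeroTwoConverse :=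
  ⟨fun hK => multiplicativeRankZeroTwoConverse_of_overK_of_hoffsteinLuo
      ⟨hP.1, selmerCorank_baseChange_quadratic_holds, hP.2⟩ hHL hK,
    multTwoConverseOverKAtTwo_of_multiplicativeRankZeroTwoConverse hP⟩

end Summit.BirchSwinnertonDyer.BirchSwinnertonDyer.Theorems

end
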